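import Summits.CriticalPhenomena.PercolationContinuityZ3.Theses.PercNearOneGluing
import Summits.CriticalPhenomena.PercolationContinuityZ3.Theorems.PercNearOneGluingAdditiveGluingML5EdgeIdentity
import Literature.Probability.Percolation.KozmaNitzanPreFKG

/-!
# Crux `PercNearOneGluing.AdditiveGluing` (stmt-CriticalPhenomena-4576), line `tieline`: (α) ⟸ (β) + (γ'')

Support file (`--supports stmt-CriticalPhenomena-4576`, helper, lead c10).  No definitions, no named facts, no sorries.

Weighted graph on `Fin n` (`μ = prodBernoulli w`), relays `u, v`, target `b`, observer `o`, spectator `c`.  Put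
`D = {u ↮ v}`, `N = {c ↮ u} ∩ {c ↮ v}`, `NJ = N ∩ {o ↔ c}` and abbreviate `d = μ(D)`, `dvb = μ(D ∩ v↔b)`,
`a_x = μ(D ∩ v↔x)`, `u_x = μ(D ∩ u↔x)`, `x_x = μ(D ∩ v↔b ∩ u↔x)`, `P_x = μ(D ∩ v↔b ∩ x↮u)`,
`f_x = μ(D ∩ {x↮u} ∩ {x↮v})` (`x ∈ {o, c}`; so `f_c = μ(D ∩ N)`), `f_J = μ(D ∩ N ∩ o↔c)`.

This file proves the reduction of the covariance transfer for `P` (registered stub `stub_k0CovTransferP_c9`),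
  (α) `dvb·(a_o μ(N) − a_c μ(NJ)) ≤ d·(P_o μ(N) − P_c μ(NJ))`,
to
* (β) the covariance transfer for `Q` (registered stub `stub_k0CovTransferQ_c9`, hypothesis `hQ`, used with the relays
  SWAPPED): `d·(x_o μ(N) − x_c μ(NJ)) ≤ dvb·(u_o μ(N) − u_c μ(NJ))`, and
* (γ'') the attachment transfer on `D` (registered stub `stub_k0AttachTransferD_c10`, hypothesis `hA`):
  `f_c μ(NJ) ≤ f_J μ(N)`.
Proof.  `P_x = dvb − x_x` (split `D ∩ v↔b` along `u↔x`), `d = a_x + u_x + f_x` (on `D` the events `v↔x`, `u↔x` are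
disjoint) and `f_J ≤ f_o` (`o↔c ↮ u, v` forces `o ↮ u, v`); hence
`d·(P_o N − P_c NJ) − dvb·(a_o N − a_c NJ) = [dvb·(u_o N − u_c NJ) − d·(x_o N − x_c NJ)] + dvb·(f_o N − f_c NJ) ≥ 0`,
the first bracket by (β), the second since `f_o N ≥ f_J N ≥ f_c NJ` by (γ'').
[cite: KozmaNitzan2024, Lemma 4 (p. 9), Question 7 (p. 36)]
-/

namespace Summit.CriticalPhenomena.PercolationContinuityZ3.Cruxes.AdditiveGluing.TieLine

open MeasureTheory Set Literature.Probability.LatticeModels Literature.Probability.Percolation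
open Summit.CriticalPhenomena.PercolationContinuityZ3.Theorems

namespace K0CovTransferPOfQ

/-! ### Real algebra of the reduction -/

/-- The algebra of (α) ⟸ (β) + (γ''): with `P_x = dvb − x_x`, `d = a_x + u_x + f_x` (`x = o, c`), `f_J ≤ f_o`,
`d·(P_o N − P_c NJ) − dvb·(a_o N − a_c NJ) = [dvb·(u_o N − u_c NJ) − d·(x_o N − x_c NJ)] + dvb·(f_o N − f_c NJ) ≥ 0`.
[folklore] -/
theorem alg {d dvb ao ac uo uc xo xc Po Pc fo fc fJ N NJ : ℝ}
    (hT : d * (xo * N - xc * NJ) ≤ dvb * (uo * N - uc * NJ)) (hA : fc * NJ ≤ fJ * N)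
    (hPo : dvb = xo + Po) (hPc : dvb = xc + Pc) (hdo : d = ao + uo + fo) (hdc : d = ac + uc + fc)
    (hfJ : fJ ≤ fo) (hN : 0 ≤ N) (hdvb : 0 ≤ dvb) :
    dvb * (ao * N - ac * NJ) ≤ d * (Po * N - Pc * NJ) := by
  have h1 : fJ * N ≤ fo * N := mul_le_mul_of_nonneg_right hfJ hN
  have h2 : 0 ≤ dvb * (fo * N - fc * NJ) := mul_nonneg hdvb (by linarith)
  have key : d * (Po * N - Pc * NJ) - dvb * (ao * N - ac * NJ) =
      (dvb * (uo * N - uc * NJ) - d * (xo * N - xc * NJ)) + dvb * (fo * N - fc * NJ) := by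
    linear_combination (-(d * N)) * hPo + (d * NJ) * hPc + (dvb * N) * hdo - (dvb * NJ) * hdc
  linarith [key, hT, h2]

variable {n : ℕ}

/-! ### Set identities on `D = {u ↮ v}` and their measure versions -/

/-- On `D = {u ↮ v}`, `u ↔ x` excludes `v ↔ x`: `D ∩ {v ↮ x} ∩ {u ↔ x} = D ∩ {u ↔ x}`. [folklore] -/
theorem D_inter_compl_inter_eq (x u v : Fin n) :
    ((openConn u v)ᶜ ∩ (openConn v x)ᶜ ∩ openConn u x : Set (BondConfig (Fin n))) = (openConn u v)ᶜ ∩ openConn u x := by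
  ext ω
  simp only [mem_inter_iff, mem_compl_iff, openConn, mem_setOf_eq]
  constructor
  · rintro ⟨⟨huv, -⟩, hux⟩
    exact ⟨huv, hux⟩
  · rintro ⟨huv, hux⟩
    exact ⟨⟨huv, fun hvx => huv (hux.trans hvx.symm)⟩, hux⟩

/-- `D ∩ {v ↮ x} ∩ {u ↮ x} = D ∩ ({x ↮ u} ∩ {x ↮ v})`. [folklore] -/
theorem D_inter_compl_inter_compl_eq (x u v : Fin n) :
    ((openConn u v)ᶜ ∩ (openConn v x)ᶜ ∩ (openConn u x)ᶜ : Set (BondConfig (Fin n))) =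
      (openConn u v)ᶜ ∩ ((openConn x u)ᶜ ∩ (openConn x v)ᶜ) := by
  ext ω
  simp only [mem_inter_iff, mem_compl_iff, openConn, mem_setOf_eq]
  constructor
  · rintro ⟨⟨huv, hvx⟩, hux⟩
    exact ⟨huv, fun hxu => hux hxu.symm, fun hxv => hvx hxv.symm⟩
  · rintro ⟨huv, hxu, hxv⟩
    exact ⟨⟨huv, fun hvx => hxv hvx.symm⟩, fun hux => hxu hux.symm⟩

/-- **`d = a_x + u_x + f_x`**: `μ(D) = μ(D ∩ v↔x) + μ(D ∩ u↔x) + μ(D ∩ {x↮u} ∩ {x↮v})` (on `D = {u ↮ v}` the events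
`v ↔ x` and `u ↔ x` are disjoint). [folklore] -/
theorem real_D_eq (w : Sym2 (Fin n) → unitInterval) (x u v : Fin n) :
    (prodBernoulli w).real ((openConn u v)ᶜ : Set (BondConfig (Fin n))) =
      (prodBernoulli w).real ((openConn u v)ᶜ ∩ openConn v x : Set (BondConfig (Fin n))) +
          (prodBernoulli w).real ((openConn u v)ᶜ ∩ openConn u x : Set (BondConfig (Fin n))) +
        (prodBernoulli w).real ((openConn u v)ᶜ ∩ ((openConn x u)ᶜ ∩ (openConn x v)ᶜ) : Set (BondConfig (Fin n))) := by
  have h1 := ML5EdgeIdentity.real_eq_inter_add_inter_compl w ((openConn u v)ᶜ : Set (BondConfig (Fin n))) (openConn v x)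
  have h2 := ML5EdgeIdentity.real_eq_inter_add_inter_compl w
    ((openConn u v)ᶜ ∩ (openConn v x)ᶜ : Set (BondConfig (Fin n))) (openConn u x)
  rw [D_inter_compl_inter_eq, D_inter_compl_inter_compl_eq] at h2
  linarith

/-- **`dvb = x_x + P_x`**: `μ(D ∩ v↔b) = μ(D ∩ v↔b ∩ u↔x) + μ(D ∩ v↔b ∩ x↮u)` (`{u ↔ x} = {x ↔ u}`). [folklore] -/
theorem real_Dvb_eq (w : Sym2 (Fin n) → unitInterval) (x b u v : Fin n) :
    (prodBernoulli w).real ((openConn u v)ᶜ ∩ openConn v b : Set (BondConfig (Fin n))) =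
      (prodBernoulli w).real ((openConn u v)ᶜ ∩ openConn v b ∩ openConn u x : Set (BondConfig (Fin n))) +
        (prodBernoulli w).real ((openConn u v)ᶜ ∩ openConn v b ∩ (openConn x u)ᶜ : Set (BondConfig (Fin n))) := by
  rw [KNPreFKG.openConn_symm u x]
  exact ML5EdgeIdentity.real_eq_inter_add_inter_compl w _ _

/-- **`f_J ≤ f_o` as sets**: `D ∩ ({c↮u} ∩ {c↮v}) ∩ {o↔c} ⊆ D ∩ ({o↮u} ∩ {o↮v})` (if `o ↔ c` and `c ↮ u` then `o ↮ u`).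
[folklore] -/
theorem D_inter_N_inter_subset (o u v c : Fin n) :
    ((openConn u v)ᶜ ∩ ((openConn c u)ᶜ ∩ (openConn c v)ᶜ) ∩ openConn o c : Set (BondConfig (Fin n))) ⊆
      (openConn u v)ᶜ ∩ ((openConn o u)ᶜ ∩ (openConn o v)ᶜ) := by
  intro ω hω
  simp only [mem_inter_iff, mem_compl_iff, openConn, mem_setOf_eq] at hω ⊢
  obtain ⟨⟨huv, hcu, hcv⟩, hoc⟩ := hω
  exact ⟨huv, fun hou => hcu (hoc.symm.trans hou), fun hov => hcv (hoc.symm.trans hov)⟩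

end K0CovTransferPOfQ

open K0CovTransferPOfQ in
/-- **(α) ⟸ (β) + (γ'')**: the covariance transfer for `Q` at ALL tuples (registered stub `stub_k0CovTransferQ_c9`,
hypothesis `hQ`; used with the relays swapped, `(u, v) ↦ (v, u)`) and the attachment transfer on `D = {u ↮ v}`
(registered stub `stub_k0AttachTransferD_c10`, hypothesis `hA`) imply the covariance transfer for `P` (registered stub
`stub_k0CovTransferP_c9`): `μ(D ∩ v↔b)·(a_o μ(N) − a_c μ(NJ)) ≤ μ(D)·(P_o μ(N) − P_c μ(NJ))`, so that
`stub_k0CovTransferP_c9 := k0CovTransferP_of_Q stub_k0CovTransferQ_c9 stub_k0AttachTransferD_c10`.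
With `P_x = dvb − x_x` (`real_Dvb_eq`), `d = a_x + u_x + f_x` (`real_D_eq`), `f_J ≤ f_o` (`D_inter_N_inter_subset`):
`d(P_o N − P_c NJ) − dvb(a_o N − a_c NJ) = [dvb(u_o N − u_c NJ) − d(x_o N − x_c NJ)] + dvb(f_o N − f_c NJ) ≥ 0` (`alg`).
[cite: KozmaNitzan2024, Lemma 4 (p. 9), Question 7 (p. 36)] -/
theorem k0CovTransferP_of_Q
    (hQ : ∀ (n : ℕ) (w : Sym2 (Fin n) → unitInterval) (o b u v c : Fin n), (Literature.Probability.LatticeModels.prodBernoulli w).real ((Literature.Probability.Percolation.openConn u v)ᶜ : Set (Literature.Probability.Percolation.BondConfig (Fin n))) * ((Literature.Probability.LatticeModels.prodBernoulli w).real ((Literature.Probability.Percolation.openConn u v)ᶜ ∩ Literature.Probability.Percolation.openConn u b ∩ Literature.Probability.Percolation.openConn v o : Set (Literature.Probability.Percolation.BondConfig (Fin n))) * (Literature.Probability.LatticeModels.prodBernoulli w).real ((Literature.Probability.Percolation.openConn c u)ᶜ ∩ (Literature.Probability.Percolation.openConn c v)ᶜ : Set (Literature.Probability.Percolation.BondConfig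 (Fin n))) - (Literature.Probability.LatticeModels.prodBernoulli w).real ((Literature.Probability.Percolation.openConn u v)ᶜ ∩ Literature.Probability.Percolation.openConn u b ∩ Literature.Probability.Percolation.openConn v c : Set (Literature.Probability.Percolation.BondConfig (Fin n))) * (Literature.Probability.LatticeModels.prodBernoulli w).real ((Literature.Probability.Percolation.openConn c u)ᶜ ∩ (Literature.Probability.Percolation.openConn c v)ᶜ ∩ Literature.Probability.Percolation.openConn o c : Set (Literature.Probability.Percolation.BondConfig (Fin n)))) ≤ (Literature.Probability.LatticeModels.prodBernoulli w).real ((Literature.Probability.Percolation.openConn u v)ᶜ ∩ Literature.Probability.Percolation.openConn u b : Set (Literature.Probability.Percolation.BondConfig (Fin n))) * ((Literature.Probability.LatticeModels.prodBernoulli w).real ((Literature.Probability.Percolation.openConn u v)ᶜ ∩ Literature.Probability.Percolation.openConn v o : Set (Literature.Probability.Percolation.BondConfig (Fin n))) * (Literature.Probability.LatticeModels.prodBernoulli w).real ((Literature.Probability.Percolation.openConn c u)ᶜ ∩ (Literature.Probability.Percolation.openConn c v)ᶜ : Set (Literature.Probability.Percolation.BondConfig (Fin n))) - (Literature.Probability.LatticeModels.prodBernoulli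 w).real ((Literature.Probability.Percolation.openConn u v)ᶜ ∩ Literature.Probability.Percolation.openConn v c : Set (Literature.Probability.Percolation.BondConfig (Fin n))) * (Literature.Probability.LatticeModels.prodBernoulli w).real ((Literature.Probability.Percolation.openConn c u)ᶜ ∩ (Literature.Probability.Percolation.openConn c v)ᶜ ∩ Literature.Probability.Percolation.openConn o c : Set (Literature.Probability.Percolation.BondConfig (Fin n)))))
    (hA : ∀ (n : ℕ) (w : Sym2 (Fin n) → unitInterval) (o u v c : Fin n),
      (prodBernoulli w).real ((openConn u v)ᶜ ∩ ((openConn c u)ᶜ ∩ (openConn c v)ᶜ) : Set (BondConfig (Fin n))) *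
          (prodBernoulli w).real ((openConn c u)ᶜ ∩ (openConn c v)ᶜ ∩ openConn o c : Set (BondConfig (Fin n))) ≤
        (prodBernoulli w).real ((openConn u v)ᶜ ∩ ((openConn c u)ᶜ ∩ (openConn c v)ᶜ) ∩ openConn o c : Set (BondConfig (Fin n))) *
          (prodBernoulli w).real ((openConn c u)ᶜ ∩ (openConn c v)ᶜ : Set (BondConfig (Fin n)))) :
    ∀ (n : ℕ) (w : Sym2 (Fin n) → unitInterval) (o b u v c : Fin n), (Literature.Probability.LatticeModels.prodBernoulli w).real ((Literature.Probability.Percolation.openConn u v)ᶜ ∩ Literature.Probability.Percolation.openConn v b : Set (Literature.Probability.Percolation.BondConfig (Fin n))) * ((Literature.Probability.LatticeModels.prodBernoulli w).real ((Literature.Probability.Percolation.openConn u v)ᶜ ∩ Literature.Probability.Percolation.openConn v o : Set (Literature.Probability.Percolation.BondConfig (Fin n))) * (Literature.Probability.LatticeModels.prodBernoulli w).real ((Literature.Probability.Percolation.openConn c u)ᶜ ∩ (Literature.Probability.Percolation.openConn c v)ᶜ : Set (Literature.Probability.Percolation.BondConfig (Fin n))) - (Literature.Probability.LatticeModels.prodBernoulli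 w).real ((Literature.Probability.Percolation.openConn u v)ᶜ ∩ Literature.Probability.Percolation.openConn v c : Set (Literature.Probability.Percolation.BondConfig (Fin n))) * (Literature.Probability.LatticeModels.prodBernoulli w).real ((Literature.Probability.Percolation.openConn c u)ᶜ ∩ (Literature.Probability.Percolation.openConn c v)ᶜ ∩ Literature.Probability.Percolation.openConn o c : Set (Literature.Probability.Percolation.BondConfig (Fin n)))) ≤ (Literature.Probability.LatticeModels.prodBernoulli w).real ((Literature.Probability.Percolation.openConn u v)ᶜ : Set (Literature.Probability.Percolation.BondConfig (Fin n))) * ((Literature.Probability.LatticeModels.prodBernoulli w).real ((Literature.Probability.Percolation.openConn u v)ᶜ ∩ Literature.Probability.Percolation.openConn v b ∩ (Literature.Probability.Percolation.openConn o u)ᶜ : Set (Literature.Probability.Percolation.BondConfig (Fin n))) * (Literature.Probability.LatticeModels.prodBernoulli w).real ((Literature.Probability.Percolation.openConn c u)ᶜ ∩ (Literature.Probability.Percolation.openConn c v)ᶜ : Set (Literature.Probability.Percolation.BondConfig (Fin n))) - (Literature.Probability.LatticeModels.prodBernoulli w).real ((Literature.Probability.Percolation.openConn u v)ᶜ ∩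 Literature.Probability.Percolation.openConn v b ∩ (Literature.Probability.Percolation.openConn c u)ᶜ : Set (Literature.Probability.Percolation.BondConfig (Fin n))) * (Literature.Probability.LatticeModels.prodBernoulli w).real ((Literature.Probability.Percolation.openConn c u)ᶜ ∩ (Literature.Probability.Percolation.openConn c v)ᶜ ∩ Literature.Probability.Percolation.openConn o c : Set (Literature.Probability.Percolation.BondConfig (Fin n)))) := by
  intro n w o b u v c
  have hT := hQ n w o b v u c
  have hNs : ((openConn c v)ᶜ ∩ (openConn c u)ᶜ : Set (BondConfig (Fin n))) = (openConn c u)ᶜ ∩ (openConn c v)ᶜ :=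
    Set.inter_comm _ _
  rw [KNPreFKG.openConn_symm v u, hNs] at hT
  exact alg hT (hA n w o u v c) (real_Dvb_eq w o b u v) (real_Dvb_eq w c b u v) (real_D_eq w o u v) (real_D_eq w c u v)
    (measureReal_mono (D_inter_N_inter_subset o u v c)) measureReal_nonneg measureReal_nonneg

end Summit.CriticalPhenomena.PercolationContinuityZ3.Cruxes.AdditiveGluing.TieLine
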